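import Summits.PneNP.PneNP.Theorems.ChebyshevTracialDesignWellConditionedCell
import Summits.PneNP.PneNP.Theorems.ChebyshevTracialDesignTightModeBudget
import HarnessLib

/-!
# Cell pnp-psdrank, route `ChebyshevTracialDesign`: the mode sum of the well-conditioned cell is `≤ 8/√n` — the cell in the clean form
# «`λ_min(X̄_t)·λ_min(Ȳ) ≥ 64/n` ⇒ design value `≤ r·Σ|w_c|·√P_{D/2+1}` at EVERY dimension `r`»

Harmonic backbone of the crux `TracialDecayExp20` (stmt-PneNP-19878), brick 87d (prover g16; MEMO-19 §2(c), §4 next prover (1)). Brick 87b-II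
(`…WellConditionedCell.value_le_tail_of_wellConditioned`) carries the explicit mode condition `Σ_{κ=1}^{D/2} R_κ·√A_κ ≤ √(μν)` with
`R_κ = Π_{i<κ}(t−2i)(n−t−2i)/((t−1−2i)(n−t−1−2i))` (brick 45b's re-weighting) and `A_κ = Π_{i<κ}(2i+1)/(n−2i)` (brick 45d's eigenvalue
profile). Here the mode sum is evaluated:
* §1 `layerRatio_le_two` — `R_κ ≤ 2` for `2κ ≤ D`, `5D ≤ 2c'+2`, `2c'+5D ≤ n` (brick 45c `layerRatio_le_one_add`: `R_κ ≤ 1 + 2κ·y`, and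
  `2κ·y ≤ 9/16` since both denominators of `y` are `≥ 4D`);
* §2 `tightProfile_le` — `A_κ ≤ (4/n)·(1/4)^κ` for `1 ≤ κ`, `2κ ≤ D`, `5D ≤ n` (the factor `i = 0` is `1/n`, every later factor is `≤ 1/4`);
* §3 **`modeSum_le`** — `Σ_{κ ∈ Icc 1 (D/2)} R_κ·√A_κ ≤ 8/√n` (termwise `≤ (4/√n)·(1/2)^κ`, geometric sum `Σ (1/2)^κ ≤ 2`);
* §4 **`value_le_tail_of_minDensity`** — hence: `n` even, an exact design `(n, t = 2c'+1, T, D ≤ 2c', B, C, w)` with `5D ≤ 2c'+2`,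
  `2c' + 5D ≤ n`; for EVERY dimension `r` and every pair of psd-contraction families `X` (odd cuts), `Y` (perfect matchings) whose slice
  sums satisfy `Σ_{|U|=t} X_U ⪰ μ·C(n,t)·I`, `Σ_M Y_M ⪰ ν·|PM|·I` with `μ, ν > 0` and **`μ·ν ≥ 64/n`**:
  `Σ_{U,M} W(U,M)·tr(X_U Y_M) ≤ r·(Σ_c|w_c|)·√(Π_{i≤D/2}(2i+1)/(n−2i))`. For the route's balanced Chebyshev designs (`D = dq n ≍ n^{1/4}`,
  `t ≥ n/4`) the side conditions hold for all large `n` and the right side is `≤ r·20·n^{−Ω(dq n)} ≤ r·e^{−a·dq n}`: THE CRUX'S BOUND HOLDS,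
  UNCONDITIONALLY AND AT EVERY DIMENSION, FOR ALL PAIRS WHOSE MEANS HAVE `λ_min(X̄_t)·λ_min(Ȳ) ≥ 64/n` (MEMO-19 §2(c)); what remains open is the
  directionally sparse regime.
[cite: Grigoriev2001, Lemma 1.4 (PDF p. 8)] [cite: BrouwerHaemers2012, Thm. 4.9.1 (PDF p. 93)] [cite: Rothvoss2017, §2 (PDF p. 6)]
[cite: GriblingDelaatLaurent2019, §5] [cite: CoppersmithRivlin1992, Thm. (p. 970)]
Stature: support/instrument (no defs, kernel lane; unconditional theorem on a sub-class of strategies). WHAT THIS IS NOT: not the crux (the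
sparse regime is open), nothing on psd rank of P_PM(K_n), no P-vs-NP content. Supports stmt-PneNP-19878.
-/

set_option linter.dupNamespace false -- `Summit.PneNP.PneNP.…`: summit = sub-problem (D-0017)

noncomputable section

namespace Summit.PneNP.PneNP.Theorems.ChebyshevTracialDesignWellConditionedDensity

open Finset Matrix Literature.Barriers.PneNP Literature.Combinatorics.Optimization
open Literature.Combinatorics.AssociationSchemes Literature.Combinatorics.AssociationSchemes.JohnsonHarmonics
open Summit.PneNP.PneNP.Theorems.ChebyshevTracialDesignTightModeBudget (layerRatio_le_one_add)
open Summit.PneNP.PneNP.Theorems.ChebyshevTracialDesignWellConditionedCell (value_le_tail_of_wellConditioned)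

variable {n r : ℕ}

/-! ### §1 The re-weighting factors are at most `2` -/

/-- **`R_κ ≤ 2`** for `2κ ≤ D`, `5D ≤ 2c'+2`, `2c' + 5D ≤ n` (both denominators of brick 45c's `y` are `≥ 4D`, so `2κ·y ≤ 9/16`).
[cite: Grigoriev2001, Lemma 1.4 (PDF p. 8)] -/
theorem layerRatio_le_two {c' D κ : ℕ} (ht : 2 * (2 * c' + 1) ≤ n) (hκD : 2 * κ ≤ D) (hD1 : 5 * D ≤ 2 * c' + 2)
    (hD2 : 2 * c' + 5 * D ≤ n) (hD : 1 ≤ D) :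
    ∏ i ∈ range κ, (((2 * c' + 1 : ℝ) - 2 * i) * ((n : ℝ) - 2 * c' - 1 - 2 * i) /
        (((2 * c' : ℝ) - 2 * i) * ((n : ℝ) - 2 * c' - 2 - 2 * i))) ≤ 2 := by
  have hκa : κ ≤ c' := by omega
  have hDpos : (0 : ℝ) < D := by exact_mod_cast hD
  have hD1r : (1 : ℝ) ≤ D := by exact_mod_cast hD
  have hd1 : (4 * D : ℝ) ≤ (2 * c' + 2 : ℝ) - 2 * κ := by
    have : (4 * D + 2 * κ : ℝ) ≤ 2 * c' + 2 := by exact_mod_cast (show 4 * D + 2 * κ ≤ 2 * c' + 2 by omega)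
    linarith
  have hd2 : (4 * D : ℝ) ≤ (n : ℝ) - 2 * c' - 2 * κ := by
    have : (4 * D + 2 * c' + 2 * κ : ℝ) ≤ n := by exact_mod_cast (show 4 * D + 2 * c' + 2 * κ ≤ n by omega)
    linarith
  have h4D : (0 : ℝ) < 4 * D := by positivity
  have hy1 : 1 / ((2 * c' + 2 : ℝ) - 2 * κ) ≤ 1 / (4 * D) := one_div_le_one_div_of_le h4D hd1
  have hy2 : 1 / ((n : ℝ) - 2 * c' - 2 * κ) ≤ 1 / (4 * D) := one_div_le_one_div_of_le h4D hd2
  have hy3 : 1 / (((2 * c' + 2 : ℝ) - 2 * κ) * ((n : ℝ) - 2 * c' - 2 * κ)) ≤ 1 / (4 * D) := by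
    refine one_div_le_one_div_of_le h4D ?_
    have h1 : (0 : ℝ) ≤ (n : ℝ) - 2 * c' - 2 * κ - 1 := by linarith
    have h2 : (0 : ℝ) ≤ (2 * c' + 2 : ℝ) - 2 * κ := by linarith
    nlinarith [mul_nonneg h2 h1]
  set y : ℝ := 1 / ((2 * c' + 2 : ℝ) - 2 * κ) + 1 / ((n : ℝ) - 2 * c' - 2 * κ) +
    1 / (((2 * c' + 2 : ℝ) - 2 * κ) * ((n : ℝ) - 2 * c' - 2 * κ)) with hy
  have hy0 : 0 ≤ y := by
    rw [hy]
    have h1 : (0 : ℝ) < (2 * c' + 2 : ℝ) - 2 * κ := by linarith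
    have h2 : (0 : ℝ) < (n : ℝ) - 2 * c' - 2 * κ := by linarith
    positivity
  have hyle : y ≤ 3 * (1 / (4 * D)) := by rw [hy]; linarith
  have hκy : 2 * κ * y ≤ 1 := by
    have hκD' : (2 * κ : ℝ) ≤ D := by exact_mod_cast hκD
    calc 2 * κ * y ≤ (D : ℝ) * (3 * (1 / (4 * D))) := mul_le_mul hκD' hyle hy0 hDpos.le
      _ = 3 / 4 := by field_simp
      _ ≤ 1 := by norm_num
  have h := layerRatio_le_one_add (n := n) ht hκa hκy
  linarith

/-! ### §2 The tight eigenvalue profile is geometrically small -/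

/-- **`A_κ ≤ (4/n)·(1/4)^κ`** for `1 ≤ κ`, `2κ ≤ D`, `5D ≤ n`: the factor `i = 0` of `A_κ = Π_{i<κ}(2i+1)/(n−2i)` is `1/n`, every later one `≤ 1/4`.
[cite: BrouwerHaemers2012, Thm. 4.9.1 (PDF p. 93)] -/
theorem tightProfile_le {D κ : ℕ} (hκ : 1 ≤ κ) (hκD : 2 * κ ≤ D) (hDn : 5 * D ≤ n) :
    ∏ i ∈ range κ, ((2 * i + 1 : ℝ) / ((n : ℝ) - 2 * i)) ≤ (4 / n) * (1 / 4 : ℝ) ^ κ := by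
  obtain ⟨k, rfl⟩ : ∃ k, κ = k + 1 := ⟨κ - 1, by omega⟩
  have hn : (0 : ℝ) < n := by exact_mod_cast (show 0 < n by omega)
  rw [prod_range_succ']
  have h0 : ((2 * (0 : ℕ) + 1 : ℝ) / ((n : ℝ) - 2 * (0 : ℕ))) = 1 / n := by norm_num
  rw [h0]
  have hcast : ∀ i : ℕ, (((i + 1 : ℕ)) : ℝ) = (i : ℝ) + 1 := fun i => by push_cast; ring
  have hfac : ∀ i ∈ range k, ((2 * ((i + 1 : ℕ) : ℝ) + 1) / ((n : ℝ) - 2 * ((i + 1 : ℕ) : ℝ))) ≤ 1 / 4 := by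
    intro i hi
    have hi' := mem_range.1 hi
    have h10 : (10 : ℝ) * i + 14 ≤ n := by
      have := (show (10 * i + 14 : ℕ) ≤ n by omega)
      exact_mod_cast this
    rw [hcast]
    rw [div_le_iff₀ (by linarith)]
    linarith
  have hfac0 : ∀ i ∈ range k, 0 ≤ ((2 * ((i + 1 : ℕ) : ℝ) + 1) / ((n : ℝ) - 2 * ((i + 1 : ℕ) : ℝ))) := by
    intro i hi
    have hi' := mem_range.1 hi
    have h10 : (10 : ℝ) * i + 14 ≤ n := by
      have := (show (10 * i + 14 : ℕ) ≤ n by omega)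
      exact_mod_cast this
    rw [hcast]
    exact div_nonneg (by positivity) (by linarith)
  have hprod : ∏ i ∈ range k, ((2 * ((i + 1 : ℕ) : ℝ) + 1) / ((n : ℝ) - 2 * ((i + 1 : ℕ) : ℝ))) ≤ (1 / 4 : ℝ) ^ k := by
    calc _ ≤ ∏ _i ∈ range k, (1 / 4 : ℝ) := prod_le_prod hfac0 hfac
      _ = (1 / 4 : ℝ) ^ k := by rw [prod_const, card_range]
  calc (∏ i ∈ range k, ((2 * ((i + 1 : ℕ) : ℝ) + 1) / ((n : ℝ) - 2 * ((i + 1 : ℕ) : ℝ)))) * (1 / n)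
      ≤ (1 / 4 : ℝ) ^ k * (1 / n) := mul_le_mul_of_nonneg_right hprod (by positivity)
    _ = (4 / n) * (1 / 4 : ℝ) ^ (k + 1) := by rw [pow_succ]; field_simp

/-! ### §3 The mode sum -/

/-- **THE MODE SUM IS `≤ 8/√n`**: `Σ_{κ=1}^{D/2} R_κ·√A_κ ≤ 8/√n` for `5D ≤ 2c'+2`, `2c' + 5D ≤ n` (termwise `R_κ√A_κ ≤ 2·(2/√n)(1/2)^κ`, and
`Σ_κ (1/2)^κ ≤ 2`). [cite: Grigoriev2001, Lemma 1.4 (PDF p. 8)] [cite: BrouwerHaemers2012, Thm. 4.9.1 (PDF p. 93)] -/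
theorem modeSum_le {c' D : ℕ} (ht : 2 * (2 * c' + 1) ≤ n) (hD1 : 5 * D ≤ 2 * c' + 2) (hD2 : 2 * c' + 5 * D ≤ n) :
    ∑ κ ∈ Icc 1 (D / 2),
        (∏ i ∈ range κ, (((2 * c' + 1 : ℝ) - 2 * i) * ((n : ℝ) - 2 * c' - 1 - 2 * i) /
            (((2 * c' : ℝ) - 2 * i) * ((n : ℝ) - 2 * c' - 2 - 2 * i)))) *
          Real.sqrt (∏ i ∈ range κ, ((2 * i + 1 : ℝ) / ((n : ℝ) - 2 * i))) ≤ 8 / Real.sqrt n := by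
  rcases Nat.eq_zero_or_pos D with hD0 | hDpos
  · subst hD0
    simp only [Nat.zero_div, show Icc 1 0 = (∅ : Finset ℕ) by rfl, sum_empty]
    positivity
  have hn : (0 : ℝ) < n := by exact_mod_cast (show 0 < n by omega)
  have hsn : 0 < Real.sqrt n := Real.sqrt_pos.2 hn
  -- termwise bound
  have hterm : ∀ κ ∈ Icc 1 (D / 2),
      (∏ i ∈ range κ, (((2 * c' + 1 : ℝ) - 2 * i) * ((n : ℝ) - 2 * c' - 1 - 2 * i) /
          (((2 * c' : ℝ) - 2 * i) * ((n : ℝ) - 2 * c' - 2 - 2 * i)))) *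
        Real.sqrt (∏ i ∈ range κ, ((2 * i + 1 : ℝ) / ((n : ℝ) - 2 * i))) ≤ (4 / Real.sqrt n) * (1 / 2 : ℝ) ^ κ := by
    intro κ hκ
    obtain ⟨hκ1, hκ2⟩ := mem_Icc.1 hκ
    have hκD : 2 * κ ≤ D := by omega
    have hR := layerRatio_le_two (n := n) ht hκD hD1 hD2 hDpos
    have hR0 := Summit.PneNP.PneNP.Theorems.ChebyshevTracialDesignWhiteningData.layerRatio_nonneg (n := n) (c' := c') (κ := κ)
      ht (by omega)
    have hA := tightProfile_le (n := n) hκ1 hκD (by omega)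
    have hsqrt : Real.sqrt (∏ i ∈ range κ, ((2 * i + 1 : ℝ) / ((n : ℝ) - 2 * i))) ≤ (2 / Real.sqrt n) * (1 / 2 : ℝ) ^ κ := by
      have htarget : (4 / n) * (1 / 4 : ℝ) ^ κ = ((2 / Real.sqrt n) * (1 / 2 : ℝ) ^ κ) ^ 2 := by
        have e1 : (2 / Real.sqrt n) ^ 2 = 4 / n := by rw [div_pow, Real.sq_sqrt hn.le]; norm_num
        have e2 : ((1 / 2 : ℝ) ^ κ) ^ 2 = (1 / 4) ^ κ := by rw [← pow_mul, mul_comm, pow_mul]; norm_num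
        rw [mul_pow, e1, e2]
      rw [htarget] at hA
      exact (Real.sqrt_le_sqrt hA).trans_eq (Real.sqrt_sq (by positivity))
    calc _ ≤ 2 * ((2 / Real.sqrt n) * (1 / 2 : ℝ) ^ κ) := mul_le_mul hR hsqrt (Real.sqrt_nonneg _) (by norm_num)
      _ = (4 / Real.sqrt n) * (1 / 2 : ℝ) ^ κ := by ring
  calc _ ≤ ∑ κ ∈ Icc 1 (D / 2), (4 / Real.sqrt n) * (1 / 2 : ℝ) ^ κ := sum_le_sum hterm
    _ ≤ ∑ κ ∈ range (D / 2 + 1), (4 / Real.sqrt n) * (1 / 2 : ℝ) ^ κ := by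
        refine sum_le_sum_of_subset_of_nonneg (fun κ hκ => ?_) fun κ _ _ => by positivity
        have := mem_Icc.1 hκ
        exact mem_range.2 (by omega)
    _ = (4 / Real.sqrt n) * ∑ κ ∈ range (D / 2 + 1), (1 / 2 : ℝ) ^ κ := by rw [mul_sum]
    _ ≤ (4 / Real.sqrt n) * 2 := mul_le_mul_of_nonneg_left (sum_geometric_two_le _) (by positivity)
    _ = 8 / Real.sqrt n := by ring

/-! ### §4 The well-conditioned cell in clean form -/

/-- **THE WELL-CONDITIONED CELL, CLEAN FORM.** `n` even, an exact design `(n, t = 2c'+1, T, D ≤ 2c', B, C, w)` with `5D ≤ 2c'+2` and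
`2c' + 5D ≤ n`. For EVERY dimension `r` and every pair of psd-contraction families `X`, `Y` with `Σ_{|U|=t} X_U ⪰ μ·C(n,t)·I`,
`Σ_M Y_M ⪰ ν·|PM|·I`, `μ, ν > 0` and `μν ≥ 64/n`:  `Σ_{U,M} W(U,M)·tr(X_U Y_M) ≤ r·(Σ_c |w_c|)·√(Π_{i ≤ D/2}(2i+1)/(n−2i))` — the design
value is at most the deep tail, with no tightness, spreadness, commutativity or low-degree hypothesis.
[cite: Rothvoss2017, §2 (PDF p. 6)] [cite: Grigoriev2001, Lemma 1.4 (PDF p. 8)] [cite: GriblingDelaatLaurent2019, §5] [cite: CoppersmithRivlin1992, Thm. (p. 970)] -/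
theorem value_le_tail_of_minDensity {c' T D : ℕ} {Bv : ℝ} {C : Finset ℕ} {w : ℕ → ℝ} (hn : Even n)
    (hdes : IsExactDesign n (2 * c' + 1) T D Bv C w) (hD : D ≤ 2 * c') (hD1 : 5 * D ≤ 2 * c' + 2) (hD2 : 2 * c' + 5 * D ≤ n)
    (X : OddSet n → Matrix (Fin r) (Fin r) ℝ) (Y : PMatch n → Matrix (Fin r) (Fin r) ℝ)
    (hX : ∀ U, (X U).PosSemidef ∧ (1 - X U).PosSemidef) (hY : ∀ M, (Y M).PosSemidef ∧ (1 - Y M).PosSemidef)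
    {μ ν : ℝ} (hμ : 0 < μ) (hν : 0 < ν) (hμν : 64 / (n : ℝ) ≤ μ * ν)
    (hXbar : ((∑ U : OddSet n, if U.1.card = 2 * c' + 1 then X U else 0) -
      (μ * (n.choose (2 * c' + 1) : ℝ)) • (1 : Matrix (Fin r) (Fin r) ℝ)).PosSemidef)
    (hYbar : ((∑ M, Y M) - (ν * (Fintype.card (PMatch n) : ℝ)) • (1 : Matrix (Fin r) (Fin r) ℝ)).PosSemidef) :
    ∑ U : OddSet n, ∑ M : PMatch n, levelWeight n (2 * c' + 1) C w U M * (X U * Y M).trace ≤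
      (r : ℝ) * ((∑ c ∈ C, |w c|) * Real.sqrt (∏ i ∈ range (D / 2 + 1), ((2 * i + 1 : ℝ) / ((n : ℝ) - 2 * i)))) := by
  have hnpos : (0 : ℝ) < n := by
    have := hdes.2.1
    exact_mod_cast (show 0 < n by omega)
  have ht : 2 * (2 * c' + 1) ≤ n := by have := hdes.2.1; omega
  refine value_le_tail_of_wellConditioned hn hdes hD X Y hX hY hμ hν hXbar hYbar ((modeSum_le (n := n) ht hD1 hD2).trans ?_)
  -- `8/√n ≤ √(μν)`
  have h64 : Real.sqrt (64 / (n : ℝ)) = 8 / Real.sqrt n := by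
    rw [Real.sqrt_div' _ hnpos.le, show (64 : ℝ) = 8 ^ 2 by norm_num, Real.sqrt_sq (by norm_num)]
  rw [← h64]
  exact Real.sqrt_le_sqrt hμν

end Summit.PneNP.PneNP.Theorems.ChebyshevTracialDesignWellConditionedDensity

end
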